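import Summits.QuantumFields.YangMills.Theorems.FluctuationComparisonRegPrIntLS2BetaLiftCurvatureLocalTower
import Literature.MathematicalPhysics.QuantumFieldTheory.Balaban1983to89.B15Prop1Carrier
import Literature.MathematicalPhysics.QuantumFieldTheory.Balaban1983to89.T4StabilityFloorUnitary
import HarnessLib

/-!
# S2β · THE SUP CHAIN ∕ (D-stage) — THE FOUR SIZE LETTERS OF FILE P (`hsU`, `haU`, `hsA`, `haA`) FROM THE PER-HEIGHT ARC PROFILE AND THE STAGE PLAQUETTE CLASS:
# `sU t := σ_s`, `aU t := a t`, `sA t := L⁻¹·σ_{s+1}`, `aA t := 4·L⁻¹·σ_{s+1}` (`s = K−(J+t+1)`) — the ρ-PACK's size half, uniform down to height 0 by px12's ✓∕⧗Q′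

Cell `ym3-torus` (YM ladder rung R3 = continuum `SU(2)` Yang–Mills on the three-torus at fixed lattice data — a RUNG: NOT d = 4, NOT infinite volume,
NOT a mass gap, NOT Clay).  Width seat «width 21» `ym3-torus-px21` (gen 25), FREE px helper on crux `stmt-QuantumFields-20520`
(`…Theses.UnitScaleTilt.FluctuationComparisonRegPrIntL`), LINE g18-1 S2β.  For px20 g24's ρ-PACK `hPρ_at_of_regionLetters` (its `hRρ` asks, per datum, for FILE P's seven
pointwise binders + size bounds): the three REGION binders are ✓`hρT_of_readSup` (px10) ∕ ✓p838062 `hρA_of_parentSups` ∕ ✓p838756 `hmA_of_parentSup`; THIS FILE supplies the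
four SIZE binders from ONE arc letter `harc : ∀ i ≤ K−J, ∀ e, ‖logVec ((g₀_i • Ū^iU₁) e)‖ ≤ σ i` (px12 ✓∕⧗Q′ `arcDecay_of_guard_below` for `i < K−J`, the guard at `i = K−J`)
and ✓`discRow'`'s stage plaquette class `hplaq`.  `--kind proof --supports stmt-QuantumFields-20520 --as helper`, count-neutral, DEFINITION-FREE (0 `def`, 0 `instance`,
0 `notation`, 0 `sorry`, default heartbeats).

WHAT IS PROVED (sorry-free; every conclusion = the corresponding binder of ✓p836058 `rhoTilde_of_regionLetters` VERBATIM at the explicit letter).  ★`hsU_of_arcs` (chord ≤ arc),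
★`haU_of_plaqSmall` (common gauge ✓`stage_eq_gaugeAct_iter` + lit ✓`dist1_plaqHol_gaugeAct` + `hplaq`), ★`hsA_of_arcs` (hat = `expPoint` of a convex combination of `L⁻¹`·parent
logs: ✓`norm_logVec_lift_le_of_forall_le` + ✓`sum_hatW_eq_one` + ✓`hatW_nonneg`), ★`haA_of_arcs` (lit ✓`dist1_plaqHol_le_four_mul`; crude — the D2 lift-curvature class would
sharpen `aA` to θ-small + `σ²`).  So the ρ-PACK's uniform size constants are `σM := max(sup_i σ i, L⁻¹·sup σ)` = `s₀ + D₁·α₀` (✓Q′) and `aM := max(ā, 4L⁻¹(s₀ + D₁α₀))`.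

HONEST SCOPE.  Plumbing of landed lemmas into landed binders; `harc`, `hplaq`, hat∕(T3)∕bottom binders are HYPOTHESES; nothing of Bałaban's renormalisation-group
analysis is asserted or proved ([Balaban1985RegularSpaces] (1.29) p.81; [Balaban1985Averaging] (8)–(11) p.19; [Balaban1987RG1] (0.3)–(0.4) pp.252–253); the ρ̃ inhabitant's
smallness conjunct (G1′), (SRC-P)∕G4-ii, `hArc`, (ST⁗)∕LOC⁗, GAP♯∘ (`stub_uniformFibreGapOrbit`, registry 3732b7df UNTOUCHED), the five registered stubs (0∕5), S2β, 20520,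
19936, 19200, `YM3TorusSU2` are NOT proved; no registered stub is closed; rung R3 — NOT d = 4, NOT infinite volume, NOT a mass gap, NOT Clay; the Yang–Mills mass gap is
NOT proved.
-/

set_option autoImplicit false

namespace Summit.QuantumFields.YangMills.Theorems.FluctuationComparisonRegPrIntLS2BetaRhoTildeSizeLetters

open Finset
open scoped Real
open Literature.MathematicalPhysics.QuantumLattice (su2Quat)
open Literature.MathematicalPhysics.QuantumFieldTheory.Balaban1983to89
open T4Continuum T3ContinuumYM3Torus T3TiltDescent T3LevelShift BlockAveraging
open B10Eq27TorusAxialLog (rel axialT)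
open T4CubeChartGnomonic (SU2)
open T4HaarSU2ExpChart (expPoint)
open T4ExpWindowSmallField (logVec)
open T3UnitLawDensityEML (ℰp)
open B15Prop1Carrier (dist1_plaqHol_gaugeAct)
open T4StabilityFloorUnitary (dist1_plaqHol_le_four_mul)
open Summit.QuantumFields.YangMills.Theorems.FluctuationComparisonRegPrIntLS2BetaGeodesicJensenLift (dist1_le_norm_logVec norm_logVec_lift_le_of_forall_le)
open Summit.QuantumFields.YangMills.Theorems.FluctuationComparisonRegPrIntLS2BetaWhitneyHatWeights (hatW_nonneg sum_hatW_eq_one)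
open Summit.QuantumFields.YangMills.Theorems.FluctuationComparisonRegPrIntLS2BetaKappaRatioTower (stage_eq_gaugeAct_iter)

section Tower

variable {F : T3Family}

/-- ★ **`hsU` FROM THE ARC PROFILE**: with per-height arcs `‖logVec ((g₀_i • Ū^iU₁) e)‖ ≤ σ i` for all `i ≤ K−J` (✓Q′ `arcDecay_of_guard_below` below the top, the guard at
the top), FILE P's `hsU` binder HOLDS at `sU t := σ (K−(J+(t+1)))` (chord ≤ arc, ✓`dist1_le_norm_logVec`). [cite: Balaban1985RegularSpaces, (1.29) p.81] -/
theorem hsU_of_arcs {J K : ℕ} (U₁ : GaugeField (F.P K) 0 SU2) (g₀ : (j : ℕ) → Site (F.P K) j → SU2) (σ : ℕ → ℝ)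
    (harc : ∀ i, i ≤ K - J → ∀ e : PBond (F.P K) i, ‖logVec (su2Quat (GaugeField.gaugeAct (g₀ i) (Averaging.iter (fun k => blockAvg (P := F.P K) (j := k) ℰp) i U₁) e))‖ ≤ σ i) :
    ∀ t, t < K - J → ∀ b : PBond (F.P K) (K - (J + (t + 1))), dist1 (GaugeField.gaugeAct (g₀ (K - (J + (t + 1)))) (Averaging.iter (fun k => blockAvg (P := F.P K) (j := k) ℰp) (K - (J + (t + 1))) U₁) b) ≤ (fun t => σ (K - (J + (t + 1)))) t := by
  intro t ht b
  exact (dist1_le_norm_logVec _).trans (harc _ (by omega) b)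

/-- ★ **`haU` FROM THE STAGE PLAQUETTE CLASS**: under the common-gauge binders ((T3)×2, bottom relation) `g₀_s • Ū^sU₁ = g_s • Ū^sU₀` (px16 ✓`stage_eq_gaugeAct_iter`), so its
plaquettes are those of `Ū^sU₀` up to conjugation (lit ✓`dist1_plaqHol_gaugeAct`), and ✓`discRow'`'s `hplaq : PlaqSmall (a t) (Ū^sU₀)` gives FILE P's `haU` at `aU t := a t`.
[cite: Balaban1985Averaging, (8)-(11) p.19; Balaban1987RG1, (0.3)-(0.4) p.252-253] -/
theorem haU_of_plaqSmall {J K : ℕ} (U₀ : GaugeField (F.P K) 0 (Matrix.specialUnitaryGroup (Fin 2) ℂ))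
    (U₁ : GaugeField (F.P K) 0 SU2) (g g₀ : (j : ℕ) → Site (F.P K) j → SU2)
    (hT3 : ∀ X : GaugeField (F.P K) 0 SU2, ∀ j, j ≤ K - J →
      Averaging.iter (fun k => blockAvg (P := F.P K) (j := k) ℰp) j (GaugeField.gaugeAct (g 0) X) =
        GaugeField.gaugeAct (g j) (Averaging.iter (fun k => blockAvg (P := F.P K) (j := k) ℰp) j X)) (hT3' : ∀ X : GaugeField (F.P K) 0 SU2, ∀ j, j ≤ K - J →
      Averaging.iter (fun k => blockAvg (P := F.P K) (j := k) ℰp) j (GaugeField.gaugeAct (g₀ 0) X) =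
        GaugeField.gaugeAct (g₀ j) (Averaging.iter (fun k => blockAvg (P := F.P K) (j := k) ℰp) j X)) (hU₀ : U₀ = GaugeField.gaugeAct (fun x => (g 0 x)⁻¹ * g₀ 0 x) U₁)
    (a : ℕ → ℝ) (hplaq : ∀ t, t < K - J → PlaqSmall (a t) (Averaging.iter (fun k => blockAvg (P := F.P K) (j := k) ℰp) (K - (J + (t + 1))) U₀)) :
    ∀ t, t < K - J → ∀ q : Plaq (F.P K) (K - (J + (t + 1))), dist1 (GaugeField.plaqHol (GaugeField.gaugeAct (g₀ (K - (J + (t + 1)))) (Averaging.iter (fun k => blockAvg (P := F.P K) (j := k) ℰp) (K - (J + (t + 1))) U₁)) q) ≤ (fun t => a t) t := by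
  intro t ht q
  have hX : GaugeField.gaugeAct (g₀ (K - (J + (t + 1)))) (Averaging.iter (fun k => blockAvg (P := F.P K) (j := k) ℰp) (K - (J + (t + 1))) U₁) = GaugeField.gaugeAct (g (K - (J + (t + 1)))) (Averaging.iter (fun k => blockAvg (P := F.P K) (j := k) ℰp) (K - (J + (t + 1))) U₀) :=
    stage_eq_gaugeAct_iter (fun k => blockAvg (P := F.P K) (j := k) ℰp) g g₀ U₁ U₀ (fun X => hT3 X _ (by omega)) (fun X => hT3' X _ (by omega)) hU₀
  rw [hX, dist1_plaqHol_gaugeAct]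
  exact (hplaq t ht q).le

/-- ★ **`hsA` FROM THE PARENT ARCS THROUGH THE HAT**: the Whitney lift is `expPoint` of a convex combination (weights `wt`, `Σ = 1`, `≥ 0`) of `L⁻¹`·parent logs, so
`‖logVec (A_U b)‖ ≤ L⁻¹·σ_{s+1}` (✓`norm_logVec_lift_le_of_forall_le`, ✓`sum_hatW_eq_one`, ✓`hatW_nonneg`) and FILE P's `hsA` holds at `sA t := L⁻¹·σ (K−(J+(t+1)) + 1)`.
[cite: Balaban1985RegularSpaces, (1.29) p.81] -/
theorem hsA_of_arcs {J K : ℕ} (U₁ : GaugeField (F.P K) 0 SU2) (g₀ : (j : ℕ) → Site (F.P K) j → SU2)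
    (wt : (j : ℕ) → PBond (F.P K) j → PBond (F.P K) (j + 1) → ℝ)
    (lift : (j : ℕ) → GaugeField (F.P K) (j + 1) SU2 → GaugeField (F.P K) j SU2)
    (hwt : ∀ j b e, wt j b e = if e.dir = b.dir ∧ (b.src b.dir - emb e.src b.dir).val < (F.P K).L then
        ∏ ν ∈ Finset.univ.erase b.dir, max 0 (1 - ((rel (emb e.src) b.src ν).natAbs : ℝ) / (F.P K).L) else 0) (hlift : ∀ j X b, lift j X b = expPoint (∑ e, wt j b e • ((((F.P K).L : ℕ) : ℝ)⁻¹ • logVec (su2Quat (X e)))))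
    (σ : ℕ → ℝ) (harc : ∀ i, i ≤ K - J → ∀ e : PBond (F.P K) i, ‖logVec (su2Quat (GaugeField.gaugeAct (g₀ i) (Averaging.iter (fun k => blockAvg (P := F.P K) (j := k) ℰp) i U₁) e))‖ ≤ σ i) :
    ∀ t, t < K - J → ∀ b : PBond (F.P K) (K - (J + (t + 1))), dist1 (lift (K - (J + (t + 1))) (GaugeField.gaugeAct (g₀ ((K - (J + (t + 1))) + 1)) (Averaging.iter (fun k => blockAvg (P := F.P K) (j := k) ℰp) ((K - (J + (t + 1))) + 1) U₁)) b) ≤ (fun t => ((((F.P K).L : ℕ) : ℝ)⁻¹ * σ ((K - (J + (t + 1))) + 1))) t := by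
  intro t ht b
  have hs1 : (K - (J + (t + 1))) + 1 ≤ (F.P K).m + (F.P K).K := by show (K - (J + (t + 1))) + 1 ≤ F.m + K; omega
  refine (dist1_le_norm_logVec _).trans ?_
  rw [hlift]
  exact norm_logVec_lift_le_of_forall_le Finset.univ (fun e _ => hatW_nonneg (wt (K - (J + (t + 1)))) (hwt (K - (J + (t + 1)))) b e)
    (sum_hatW_eq_one hs1 (wt (K - (J + (t + 1)))) (hwt (K - (J + (t + 1)))) b) _ (by positivity) (fun e _ => harc _ (by omega) e)

/-- ★ **`haA` FROM `hsA`**: a plaquette word has four letters, so `dist1 (P_{A_U} q) ≤ 4·(L⁻¹·σ_{s+1})` (lit ✓`dist1_plaqHol_le_four_mul`) and FILE P's `haA` holds at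
`aA t := 4·(L⁻¹·σ (K−(J+(t+1)) + 1))` (crude; the D2 lift-curvature class would give the θ-small edition). [cite: Balaban1985RegularSpaces, (1.29) p.81] -/
theorem haA_of_arcs {J K : ℕ} (U₁ : GaugeField (F.P K) 0 SU2) (g₀ : (j : ℕ) → Site (F.P K) j → SU2)
    (wt : (j : ℕ) → PBond (F.P K) j → PBond (F.P K) (j + 1) → ℝ)
    (lift : (j : ℕ) → GaugeField (F.P K) (j + 1) SU2 → GaugeField (F.P K) j SU2)
    (hwt : ∀ j b e, wt j b e = if e.dir = b.dir ∧ (b.src b.dir - emb e.src b.dir).val < (F.P K).L then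
        ∏ ν ∈ Finset.univ.erase b.dir, max 0 (1 - ((rel (emb e.src) b.src ν).natAbs : ℝ) / (F.P K).L) else 0) (hlift : ∀ j X b, lift j X b = expPoint (∑ e, wt j b e • ((((F.P K).L : ℕ) : ℝ)⁻¹ • logVec (su2Quat (X e)))))
    (σ : ℕ → ℝ) (harc : ∀ i, i ≤ K - J → ∀ e : PBond (F.P K) i, ‖logVec (su2Quat (GaugeField.gaugeAct (g₀ i) (Averaging.iter (fun k => blockAvg (P := F.P K) (j := k) ℰp) i U₁) e))‖ ≤ σ i) :
    ∀ t, t < K - J → ∀ q : Plaq (F.P K) (K - (J + (t + 1))), dist1 (GaugeField.plaqHol (lift (K - (J + (t + 1))) (GaugeField.gaugeAct (g₀ ((K - (J + (t + 1))) + 1)) (Averaging.iter (fun k => blockAvg (P := F.P K) (j := k) ℰp) ((K - (J + (t + 1))) + 1) U₁))) q) ≤ (fun t => (4 * ((((F.P K).L : ℕ) : ℝ)⁻¹ * σ ((K - (J + (t + 1))) + 1)))) t := by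
  intro t ht q
  exact dist1_plaqHol_le_four_mul (fun b => hsA_of_arcs U₁ g₀ wt lift hwt hlift σ harc t ht b) q

end Tower

end Summit.QuantumFields.YangMills.Theorems.FluctuationComparisonRegPrIntLS2BetaRhoTildeSizeLetters
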